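import Summits.MatrixMultiplication.MatrixMultiplication.Theorems.FarEdgeDescentNearVertex
import Summits.MatrixMultiplication.MatrixMultiplication.Theorems.FarEdgeDescentAlphaPrice
import HarnessLib

/-!
# Route `FarEdgeDescent` — the FOLD couples the near atom and the far atom of the dichotomy
(lens-2, gen 24; support module, def-free)

The cut of record `ω(ℂ) = 2 ⟺ FiniteSaturation ∧ AnchoredLogConvexity` (`FarEdgeDescentChord.node_iff`,
deciding theorem `closes`) is UNCHANGED.  Gens 21–23 classified the failure `ω(ℂ) > 2` of the square–cube
pencil `f(x) := ω(1,x,1)` by two LOCAL atoms: at the NEAR vertex `α` (departure from the floor `2`) the profile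
has a CORNER (N2: `∃ s > 0, f ≥ 2 + s(x−α)`) or is TANGENTIAL (N3: `f` differentiable at `α`)
(`FarEdgeDescentNearVertex.not_mm_iff_corner_or_tangential`); at the FAR contact `β` (first zero of the
excess `e(x) := f(x) − (x+1)`, when it exists) the landing is TRANSVERSAL (W2) or TANGENTIAL (W3)
(`FarEdgeDescentContactTrichotomy`).  Gen 23 recorded the two atoms as «independent».  This file shows they
are NOT independent: the lineage's own gen-8 FOLD
`d(2/(K+1)) ≤ (2/(K+1))·e(K)` (`FarEdgeDescentAlphaPrice.dualDefect_le_excess`, `d(x) := f(x) − 2`; it is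
Lotti–Romani duality `(K+1)·ω(1,1,2/(K+1)) ≤ 2·ω(1,K,1)` read on the pencil) TRANSPORTS the near support line
to a far lower bound:

* §1  `f ≥ 2 + s(x − a)` on `ℝ` ⟹ `e(K) ≥ s(1 − a(K+1)/2)` for every `K > 0`; with `a = α` this is
  `e(K) ≥ (sα/2)·(β⋆ − K)`, `β⋆ := 2/α − 1` the FOLD THRESHOLD (the far shape dual to `α`).
* §2  Every saturated shape lies at or beyond the fold threshold: `f(b) = b+1, b > 0 ⟹ α(b+1) ≥ 2`
  (gen 8 `alpha_ge_of_saturated`, product form).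
* §3 ★ COUPLING IN FOLD-TIGHT WORLDS (`f(β⋆) = β⋆+1`, i.e. the first zero of `e` IS the fold threshold):
  a near CORNER of slope `s` forces a TRANSVERSAL far landing at `β⋆` with contact angle `1 − a ≥ sα/2`
  (`transversal_of_corner_at_fold`); contrapositively a TANGENTIAL far landing at `β⋆` forces a TANGENTIAL near
  departure, `f` differentiable at `α` (`differentiableAt_alpha_of_differentiableAt_fold`).  So in the refined
  atom table `(N2|N3) × (W2|W3) × (fold-tight | fold-slack)` of `¬S ∧ FiniteSaturation` exactly ONE cell is
  empty: `N2 ∧ W3 ∧ tight`.  (The other seven cells and both `¬FiniteSaturation` near types are realised by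
  3D-LAWFUL model worlds — support functions of explicit dark sets obeying every typed law of `omegaRect`,
  the fold included: companion module `FarEdgeDescentSpectralWorlds`.)
* §4  THE FOLD-TIGHT DIAL.  `S ⟹ FoldTight ⟹ FiniteSaturation`, where
  `FoldTight :≡ ∃ b, α(b+1) = 2 ∧ f(b) = b+1` («the far shape dual to the dual exponent is saturated»); both
  implications are strict by the companion worlds (`W_poly`: FoldTight ∧ ¬S; `W_slack`: FS ∧ ¬FoldTight).
  FoldTight is NOT filed as an item (OPS: no new splits until a leaf moves); it is the special-side shape
  statement that makes the near/far atoms talk to each other.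

All statements are over `omegaRect ℂ`, `dualExponentAlpha ℂ`, `_root_.MatrixMultiplication` and the route decl
`FiniteSaturation`; no `def`s.  `α > 0` is never assumed: where needed it is derived from the fold-tight
hypothesis itself (`alpha_pos_of_fold`).
-/

set_option linter.dupNamespace false

noncomputable section

namespace Summit.MatrixMultiplication.MatrixMultiplication.Theorems.FarEdgeDescentFoldCoupling

open Literature.Computability.AlgebraicComplexity
open Summit.MatrixMultiplication.MatrixMultiplication.Theses.FarEdgeDescent (FiniteSaturation)
open Summit.MatrixMultiplication.MatrixMultiplication.Theorems.FarEdgeDescentChord (finiteSaturation_of_mm)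
open Summit.MatrixMultiplication.MatrixMultiplication.Theorems.FarEdgeDescentAlphaPrice
open Summit.MatrixMultiplication.MatrixMultiplication.Theorems.FarEdgeDescentNearVertex
open Summit.MatrixMultiplication.MatrixMultiplication.Theorems.FarEdgeDescentContactTrichotomy
open Summit.MatrixMultiplication.MatrixMultiplication.Theorems.FarEdgeDescentSmoothCut
open Filter Topology Set

/-! ## §1 The fold transports a near support line to a far excess lower bound -/

/-- **Fold transport.**  A global support line `f(x) ≥ 2 + s(x − a)` (any `s`) gives, through the fold
`d(2/(K+1)) ≤ (2/(K+1))·e(K)`, the far lower bound `e(K) ≥ s·(1 − a(K+1)/2)` for every `K > 0`. -/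
theorem excess_ge_of_support_line {a s K : ℝ} (hK : 0 < K)
    (hsup : ∀ x : ℝ, 2 + s * (x - a) ≤ omegaRect ℂ 1 x 1) :
    s * (1 - a * (K + 1) / 2) ≤ omegaRect ℂ 1 K 1 - (K + 1) := by
  have hK1 : 0 < K + 1 := by linarith
  have h1 := hsup (2 / (K + 1))
  have h2 := dualDefect_le_excess hK
  have h3 : s * (2 / (K + 1) - a) ≤ 2 / (K + 1) * (omegaRect ℂ 1 K 1 - (K + 1)) := by linarith
  have h4 := mul_le_mul_of_nonneg_left h3 (le_of_lt (by positivity : (0 : ℝ) < (K + 1) / 2))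
  have hu : (K + 1) / 2 * (2 / (K + 1)) = 1 := by field_simp
  linear_combination h4 + (omegaRect ℂ 1 K 1 - (K + 1) - s) * hu

/-- **Fold transport of a near corner.**  A corner of slope `s` at the dual exponent `α` (the N2 atom of
`FarEdgeDescentNearVertex`) forces `e(K) ≥ s·(1 − α(K+1)/2)` for every `K > 0` — positive exactly for
`K < β⋆ := 2/α − 1`, the fold threshold. -/
theorem excess_ge_of_corner {s K : ℝ} (hK : 0 < K)
    (hsup : ∀ x : ℝ, 2 + s * (x - dualExponentAlpha ℂ) ≤ omegaRect ℂ 1 x 1) :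
    s * (1 - dualExponentAlpha ℂ * (K + 1) / 2) ≤ omegaRect ℂ 1 K 1 - (K + 1) :=
  excess_ge_of_support_line hK hsup

/-- **Fold transport of the right derivative at `α`.**  With the maximal support slope `s = D⁺f(α)`
(`FarEdgeDescentNearVertex.support_line`): `D⁺f(α)·(1 − α(K+1)/2) ≤ e(K)` for every `K > 0`. -/
theorem excess_ge_of_rightDeriv {K : ℝ} (hK : 0 < K) :
    derivWithin (fun y : ℝ => omegaRect ℂ 1 y 1) (Ioi (dualExponentAlpha ℂ)) (dualExponentAlpha ℂ) *
        (1 - dualExponentAlpha ℂ * (K + 1) / 2) ≤ omegaRect ℂ 1 K 1 - (K + 1) :=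
  excess_ge_of_support_line hK support_line

/-! ## §2 The fold threshold: saturated shapes lie at or beyond `2/α − 1` -/

/-- A saturated shape is at least the cube: `f(b) = b + 1 ⟹ 1 ≤ b` (floor `f ≥ 2`). -/
theorem one_le_of_saturated {b : ℝ} (hsat : omegaRect ℂ 1 b 1 = b + 1) : 1 ≤ b := by
  have h := two_le_omegaRect_one_mid_one ℂ b
  linarith

/-- **Fold threshold (product form of gen 8 `alpha_ge_of_saturated`).**  `f(b) = b+1, b > 0 ⟹ 2 ≤ α·(b+1)`:
every saturated far shape lies at or beyond `β⋆ = 2/α − 1`. -/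
theorem two_le_alpha_mul_of_saturated {b : ℝ} (hb : 0 < b) (hsat : omegaRect ℂ 1 b 1 = b + 1) :
    2 ≤ dualExponentAlpha ℂ * (b + 1) := by
  have h := alpha_ge_of_saturated hb hsat
  have hb1 : 0 < b + 1 := by linarith
  rw [div_le_iff₀ hb1] at h
  linarith

/-- Contrapositive: strictly below the fold threshold nothing is saturated. -/
theorem not_saturated_below_fold {b : ℝ} (hb : 0 < b) (hlt : dualExponentAlpha ℂ * (b + 1) < 2) :
    omegaRect ℂ 1 b 1 ≠ b + 1 :=
  fun hsat => absurd (two_le_alpha_mul_of_saturated hb hsat) (not_le.mpr hlt)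

/-- In a fold-tight world `α > 0`, unconditionally (no `vxxz` fact needed). -/
theorem alpha_pos_of_fold {b : ℝ} (hb : dualExponentAlpha ℂ * (b + 1) = 2)
    (hsat : omegaRect ℂ 1 b 1 = b + 1) : 0 < dualExponentAlpha ℂ := by
  have h1 := one_le_of_saturated hsat
  by_contra h
  push Not at h
  nlinarith

/-- In a fold-tight world the tight shape is `b = 2/α − 1`. -/
theorem eq_fold_threshold {b : ℝ} (hb : dualExponentAlpha ℂ * (b + 1) = 2)
    (hsat : omegaRect ℂ 1 b 1 = b + 1) : b = 2 / dualExponentAlpha ℂ - 1 := by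
  have ha := alpha_pos_of_fold hb hsat
  field_simp
  linarith

/-- Under `ω(ℂ) > 2` a fold-tight shape is a genuine far shape: `1 < b`. -/
theorem one_lt_fold_of_not_mm (hS : ¬ _root_.MatrixMultiplication) {b : ℝ}
    (hb : dualExponentAlpha ℂ * (b + 1) = 2) (hsat : omegaRect ℂ 1 b 1 = b + 1) : 1 < b := by
  have ha1 := not_mm_iff_alpha_lt_one.mp hS
  have h1 := one_le_of_saturated hsat
  by_contra h
  push Not at h
  have hb1 : b = 1 := le_antisymm h h1
  subst hb1
  linarith

/-! ## §3 ★ Coupling in fold-tight worlds: near corner ⟹ transversal far landing; tangential far landing ⟹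
tangential near departure -/

/-- ★ **Corner ⟹ transversal landing at the fold threshold.**  If the profile has a near CORNER of slope
`s > 0` at `α` and the fold threshold `b` (`α(b+1) = 2`) is saturated, then the far landing at `b` is
TRANSVERSAL in the exact shape of `FarEdgeDescentContactTrichotomy` (W2): saturated on `[b, ∞)` and
`f(x) ≥ f(b) − a(b − x)` on `[1, b]` with `a = 1 − sα/2 < 1` — the far contact angle is at least `α/2` times
the near corner slope. -/
theorem transversal_of_corner_at_fold {s b : ℝ} (hs : 0 < s)
    (hsup : ∀ x : ℝ, 2 + s * (x - dualExponentAlpha ℂ) ≤ omegaRect ℂ 1 x 1)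
    (hb : dualExponentAlpha ℂ * (b + 1) = 2) (hsat : omegaRect ℂ 1 b 1 = b + 1) :
    ∃ a : ℝ, a < 1 ∧ (∀ y : ℝ, b ≤ y → omegaRect ℂ 1 y 1 = y + 1) ∧
      ∀ x : ℝ, 1 ≤ x → x ≤ b → omegaRect ℂ 1 b 1 - a * (b - x) ≤ omegaRect ℂ 1 x 1 := by
  have ha := alpha_pos_of_fold hb hsat
  refine ⟨1 - s * dualExponentAlpha ℂ / 2, by nlinarith, fun y hy => saturated_of_le hsat hy, ?_⟩
  intro x hx1 _hxb
  have h := excess_ge_of_corner (by linarith) hsup (K := x)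
  rw [hsat]
  have e1 : s * (1 - dualExponentAlpha ℂ * (x + 1) / 2) = s * dualExponentAlpha ℂ / 2 * (b - x) := by
    have : (1 : ℝ) = dualExponentAlpha ℂ * (b + 1) / 2 := by rw [hb]; norm_num
    calc s * (1 - dualExponentAlpha ℂ * (x + 1) / 2)
        = s * (dualExponentAlpha ℂ * (b + 1) / 2 - dualExponentAlpha ℂ * (x + 1) / 2) := by rw [← this]
      _ = s * dualExponentAlpha ℂ / 2 * (b - x) := by ring
  rw [e1] at h
  linarith

/-- A quantitative restatement: in a fold-tight world the near corner slope `s` and ANY far landing slope `a`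
at the threshold (a line `f(b) − a(b−x) ≥ f(x)` lying ABOVE the profile on `[1,b]`, e.g. the left derivative)
satisfy `s·α/2 ≤ 1 − a`. -/
theorem corner_slope_le_contact_angle {s b a : ℝ}
    (hsup : ∀ x : ℝ, 2 + s * (x - dualExponentAlpha ℂ) ≤ omegaRect ℂ 1 x 1)
    (hb : dualExponentAlpha ℂ * (b + 1) = 2) (hsat : omegaRect ℂ 1 b 1 = b + 1) (hb1 : 1 < b)
    (habove : ∀ x : ℝ, 1 ≤ x → x ≤ b → omegaRect ℂ 1 x 1 ≤ omegaRect ℂ 1 b 1 - a * (b - x)) :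
    s * dualExponentAlpha ℂ / 2 ≤ 1 - a := by
  have h := excess_ge_of_corner one_pos hsup (K := 1)
  have h1 := habove 1 le_rfl hb1.le
  rw [hsat] at h1
  have e1 : s * (1 - dualExponentAlpha ℂ * (1 + 1) / 2) = s * dualExponentAlpha ℂ / 2 * (b - 1) := by
    have : (1 : ℝ) = dualExponentAlpha ℂ * (b + 1) / 2 := by rw [hb]; norm_num
    calc s * (1 - dualExponentAlpha ℂ * (1 + 1) / 2)
        = s * (dualExponentAlpha ℂ * (b + 1) / 2 - dualExponentAlpha ℂ * (1 + 1) / 2) := by rw [← this]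
      _ = s * dualExponentAlpha ℂ / 2 * (b - 1) := by ring
  rw [e1] at h
  have hb0 : 0 < b - 1 := by linarith
  by_contra hc
  push Not at hc
  nlinarith

/-- ★ **Corner ⟹ the profile is NOT differentiable at the fold threshold** (`ω(ℂ) > 2`). -/
theorem not_differentiableAt_fold_of_corner (hS : ¬ _root_.MatrixMultiplication) {s b : ℝ} (hs : 0 < s)
    (hsup : ∀ x : ℝ, 2 + s * (x - dualExponentAlpha ℂ) ≤ omegaRect ℂ 1 x 1)
    (hb : dualExponentAlpha ℂ * (b + 1) = 2) (hsat : omegaRect ℂ 1 b 1 = b + 1) :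
    ¬ DifferentiableAt ℝ (fun y : ℝ => omegaRect ℂ 1 y 1) b := by
  obtain ⟨a, ha, hright, hleft⟩ := transversal_of_corner_at_fold hs hsup hb hsat
  exact not_differentiableAt_of_transversal (one_lt_fold_of_not_mm hS hb hsat) ha hright hleft

/-- ★ **Tangential far landing at the fold threshold ⟹ tangential near departure.**  If `ω(ℂ) > 2`, the fold
threshold `b` is saturated and the profile is differentiable at `b` (W3-type landing of
`FarEdgeDescentContactTrichotomy`), then the profile is differentiable at `α` (N3-type departure of
`FarEdgeDescentNearVertex`): the cell `N2 ∧ W3 ∧ fold-tight` of the atom table is EMPTY. -/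
theorem differentiableAt_alpha_of_differentiableAt_fold (hS : ¬ _root_.MatrixMultiplication) {b : ℝ}
    (hb : dualExponentAlpha ℂ * (b + 1) = 2) (hsat : omegaRect ℂ 1 b 1 = b + 1)
    (hd : DifferentiableAt ℝ (fun y : ℝ => omegaRect ℂ 1 y 1) b) :
    DifferentiableAt ℝ (fun y : ℝ => omegaRect ℂ 1 y 1) (dualExponentAlpha ℂ) := by
  rcases not_mm_iff_corner_or_tangential.mp hS with ⟨_, s, hs, hsup⟩ | ⟨_, h⟩
  · exact absurd hd (not_differentiableAt_fold_of_corner hS hs hsup hb hsat)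
  · exact h

/-- The same in derivative form: a tangential landing at the fold threshold forces `D⁺f(α) = 0`. -/
theorem rightDeriv_alpha_eq_zero_of_differentiableAt_fold (hS : ¬ _root_.MatrixMultiplication) {b : ℝ}
    (hb : dualExponentAlpha ℂ * (b + 1) = 2) (hsat : omegaRect ℂ 1 b 1 = b + 1)
    (hd : DifferentiableAt ℝ (fun y : ℝ => omegaRect ℂ 1 y 1) b) :
    derivWithin (fun y : ℝ => omegaRect ℂ 1 y 1) (Ioi (dualExponentAlpha ℂ)) (dualExponentAlpha ℂ) = 0 :=
  differentiableAt_alpha_iff.mp (differentiableAt_alpha_of_differentiableAt_fold hS hb hsat hd)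

/-! ## §4 The fold-tight dial: `S ⟹ FoldTight ⟹ FiniteSaturation` -/

/-- `S ⟹ FoldTight`: under `ω(ℂ) = 2`, `α = 1` and the fold threshold `b = 1` (the cube) is saturated. -/
theorem foldTight_of_mm (hS : _root_.MatrixMultiplication) :
    ∃ b : ℝ, dualExponentAlpha ℂ * (b + 1) = 2 ∧ omegaRect ℂ 1 b 1 = b + 1 := by
  have hω : omega ℂ = 2 := (_root_.MatrixMultiplication_iff).mp hS
  have hα : dualExponentAlpha ℂ = 1 := (dualExponentAlpha_eq_one_iff ℂ).mpr hω
  refine ⟨1, by rw [hα]; norm_num, ?_⟩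
  rw [omegaRect_one_one_one, hω]
  norm_num

/-- `FoldTight ⟹ FiniteSaturation`: a saturated fold threshold `b` gives the saturated integer shape `⌈b⌉ ≥ 2`
(when `ω(ℂ) > 2`, `b > 1`; when `ω(ℂ) = 2` the special leaf holds outright). -/
theorem finiteSaturation_of_foldTight {b : ℝ} (hb : dualExponentAlpha ℂ * (b + 1) = 2)
    (hsat : omegaRect ℂ 1 b 1 = b + 1) : FiniteSaturation := by
  by_cases hS : _root_.MatrixMultiplication
  · exact finiteSaturation_of_mm hS
  · have hb1 := one_lt_fold_of_not_mm hS hb hsat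
    refine ⟨⌈b⌉₊, ?_, saturated_of_le hsat (Nat.le_ceil b)⟩
    have : 1 < ⌈b⌉₊ := Nat.lt_ceil.mpr (by exact_mod_cast hb1)
    omega

/-- `FoldTight` in threshold-free form: `∃ b, α(b+1) = 2 ∧ f(b) = b+1 ⟺ 0 < α ∧ f(2/α − 1) = 2/α`. -/
theorem foldTight_iff :
    (∃ b : ℝ, dualExponentAlpha ℂ * (b + 1) = 2 ∧ omegaRect ℂ 1 b 1 = b + 1) ↔
      (0 < dualExponentAlpha ℂ ∧
        omegaRect ℂ 1 (2 / dualExponentAlpha ℂ - 1) 1 = 2 / dualExponentAlpha ℂ) := by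
  constructor
  · rintro ⟨b, hb, hsat⟩
    have ha := alpha_pos_of_fold hb hsat
    have e := eq_fold_threshold hb hsat
    refine ⟨ha, ?_⟩
    rw [← e, hsat, e]
    ring
  · rintro ⟨ha, h⟩
    refine ⟨2 / dualExponentAlpha ℂ - 1, ?_, ?_⟩
    · field_simp
      ring
    · rw [h]
      ring

/- The dial end to end: `S ⟹ FiniteSaturation` (tree: `FarEdgeDescentChord.finiteSaturation_of_mm`)
factors as `finiteSaturation_of_foldTight ∘ foldTight_of_mm`; both steps are strict by the 3D-lawful worlds of
`FarEdgeDescentSpectralWorlds` (`W_poly` is fold-tight with `ω_W = 9/4 > 2`; `W_slack` has a saturated integer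
shape strictly beyond its unsaturated fold threshold).  Not restated as a theorem (it would duplicate
`finiteSaturation_of_mm`). -/

end Summit.MatrixMultiplication.MatrixMultiplication.Theorems.FarEdgeDescentFoldCoupling

end
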